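import Literature.MathematicalPhysics.QuantumFieldTheory.Balaban1983to89.B8CubeMemberBoxRows
import Literature.MathematicalPhysics.QuantumFieldTheory.Balaban1983to89.B8Eq191FlatTowerGram
import Literature.MathematicalPhysics.QuantumFieldTheory.Balaban1983to89.B8LambdaSpaceKLevel

/-!
# `Balaban1983to89.B8Eq348CubeMemberTowerGramAlgebra` — [Balaban1985RegularSpaces] ∕ [Balaban1985BackgroundPropagators] (3.48): the ALGEBRA of the consumer's
# averaging matrix `Q` and flat matrix `T` on the cube member — `QQᵀ = diag(L^{−(d+1)j_p})`, `T = η⁻²A_D + QᵀWQ`, `QT = η⁻²QA_D + diag(L^{−(d+1)j}w_j)Q`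
# (first brick of the 𝒢-bound programme for `𝒢 = (QT⁻²Qᵀ)⁻¹`, the p6 flat road's one open real estimate)

statement-level skeleton of published theorems with citation tags; proofs where landed; nothing here is a claim about the
Yang–Mills mass gap

`[Balaban1985RegularSpaces]` ("B8", CMP **99** (1985) 75–102) (1.31) p. 81, (1.91) p. 91 (the form `⟨λ, (Δ + Q′*aQ′)λ⟩`), p. 93; `[Balaban1985BackgroundPropagators]` ("[4]")
Theorem 3.2 (3.48) p. 398 (the operator `(Q′G′²Q′*)⁻¹`); `[Balaban1984PropagatorsII]` (2.13)–(2.14) p. 225.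

CITATION HEADER (lean-in-tree rule).  Cell `pub-ymgap` (YM Track A, HUMAN RULING D-0062), DAG node N05 = [B8], seat `pub-ymgap-dag-n05-c` (g9; (R1′) programme, file F9).
After F1–F8 the p6 flat road's open real estimate is the 𝒢-bound for `𝒢 = (QT⁻²Qᵀ)⁻¹` (hypothesis `hG` of `B8Eq192CubeMemberOfReal1G.real2_of_real1_gbound`).  Every
attack on it (coercive lower bounds, the tower parametrix of `HOME/pub-ymgap-dag-n05-c/R23-DESIGN.md` (iii), the dictionary to p21's `Xk D a` on the Neumann box)
starts from the matrix algebra typed here, in the consumer's VERBATIM shapes: the towers are disjoint and their blocks have exactly `(L^{d+1})^{j}` sites, so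
`QQᵀ` is the diagonal `diag(L^{−(d+1)j_p})` (in particular `Q` has a right inverse `Qᵀ·diag(L^{(d+1)j_p})`); the mass term of `K` is `Qᵀ·diag(w_{j_p})·Q`, so
`T = η⁻²A_D + QᵀWQ` with `A_D` the Dirichlet stencil matrix on `□₀`; hence `QT = η⁻²QA_D + diag(L^{−(d+1)j_p}w_{j_p})·Q` (block averages of `Tλ` = block
averages of `η⁻²(−Δλ)` + `a′_j η⁻²L^{−2j}`-multiples of block averages of `λ`).

WHAT THIS FILE PROVES (kernel-checked; theorems only; any `L ≥ 1`, dimension `d + 1`, cube datum with `L ≤ ρ`, truncation `n ≤ k`, any weights `w`).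
* §1 `card_filter_block_eq` — a block of side `Lʲ` inside `S` has EXACTLY `(L^{d+1})ʲ` sites (g8's chart `block_eq_image` is injective; cf. the `≤` versions
  `B8Eq198CubeMemberOfReal12.card_filter_block_le`, `B8Eq1101CubeMemberParametrixIdentity.card_filter_block_le`).
* §2 ★ `towerGram_QQt` — `Q * Qᵀ = Matrix.diagonal (fun p => (L^{−(d+1)})^{j_p})`.
* §3 ★ `massTerm_eq_QtWQ` (the level sum of `K` is the `(x,z)` entry of `Qᵀ·diag(w_{j_p})·Q`), ★ `flatMatrix_eq_lap_add_QtWQ` (`T = η⁻²•A_D + QᵀWQ`),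
  ★ `Q_mul_flatMatrix` (`Q * T = η⁻²•(Q * A_D) + diag(L^{−(d+1)j_p}w_{j_p}) * Q`).

HONEST SCOPE ∕ NOT CLAIMED.  Linear algebra and counting only; no estimate; the 𝒢-bound stays OPEN.  Count-neutral; N05 NOT discharged; one finite `T⁴` programme at
fixed `ε`, Bałaban as printed; nothing continuum ∕ ℝ⁴ ∕ OS ∕ mass-gap ∕ Clay.  No `sorry`, no `def`, no `instance`, no `notation`.  Unit `pub-ymgap-dag-n05-c` (g9), 2026-08-27.

RELATED IN THE TREE, NOT DUPLICATED: `B8Eq191FlatTowerGram.{towerQT_mulVec_injective, isUnit_towerGram}` (n05-e: `Qᵀ` injective, `QT⁻²Qᵀ` a unit — consequences,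
not the identities), `B8Eq191FlatLettersCubeMember.{towers_disjoint_cube, tower_meets_cube}`, `B8Eq191FlatDirichletCoercive.{block_eq_image, towerBlock_subset_cube}`
(n05-e ∕ g8, USED), `B8CubeMemberBoxRows.K_row_sum` ∕ `B8Eq198CubeMemberOfReal12.K_row_sum_zeroExt` (row-wise forms of §3 against a vector).
-/
noncomputable section

namespace Literature.MathematicalPhysics.QuantumFieldTheory.Balaban1983to89.B8Eq348CubeMemberTowerGramAlgebra

open scoped Matrix
open B7Prop1Explicit (e)
open B8Eq131CubesAdmissible (cubeFam)
open B8CubeMemberZd (cubeLamS)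
open B8Eq191FlatLettersCubeMember (tower_meets_cube towers_disjoint_cube)
open B8Eq191FlatDirichletCoercive (towerBlock_subset_cube block_eq_image)
open Literature.MathematicalPhysics.QuantumLattice (blockMap blockBase)

variable {d : ℕ}

/-! ## §1 Exact block cardinality -/

/-- A block of side `Lʲ` lying in `S` has EXACTLY `(L^{d+1})ʲ` sites (the chart of g8's `block_eq_image` is injective). [folklore]
[cite: Balaban1985RegularSpaces, p.79 (the blocks `Bʲ(y)`)] -/
theorem card_filter_block_eq {L : ℕ} (hL : 1 ≤ L) (j : ℕ) (S : Finset (Fin (d + 1) → ℤ)) (x : Fin (d + 1) → ℤ)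
    (hfull : ∀ z, blockMap (L ^ j) z = blockMap (L ^ j) x → z ∈ S) :
    ((S.filter (fun z => blockMap (L ^ j) z = blockMap (L ^ j) x)).card : ℝ) = ((L : ℝ) ^ (d + 1)) ^ j := by
  classical
  obtain ⟨n, hn⟩ : ∃ n, L ^ j = n + 1 := ⟨L ^ j - 1, (Nat.sub_add_cancel (Nat.one_le_pow _ _ hL)).symm⟩
  have hB : ∀ z, z ∈ S.filter (fun z => blockMap (L ^ j) z = blockMap (L ^ j) x) ↔ blockMap (n + 1) z = blockMap (n + 1) x := by
    intro z
    rw [Finset.mem_filter, hn]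
    exact ⟨fun h => h.2, fun h => ⟨hfull z (by rw [hn]; exact h), h⟩⟩
  rw [block_eq_image n (blockMap (n + 1) x) _ hB]
  have hinj : Function.Injective (fun t : Fin (d + 1) → Fin (n + 1) => blockBase (n + 1) (blockMap (n + 1) x) + fun i => ((t i : ℕ) : ℤ)) := by
    intro t t' h
    funext i
    have hi := congr_fun h i
    simp only [Pi.add_apply, add_right_inj, Nat.cast_inj] at hi
    exact Fin.ext hi
  rw [Finset.card_image_of_injective _ hinj, Finset.card_univ, Fintype.card_pi, Finset.prod_const, Fintype.card_fin, Finset.card_univ,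
    Fintype.card_fin]
  have : ((n + 1 : ℕ) : ℝ) = (L : ℝ) ^ j := by rw [← hn]; push_cast; ring
  push_cast
  rw [show ((n : ℝ) + 1) = ((n + 1 : ℕ) : ℝ) by push_cast; ring, this, ← pow_mul, mul_comm, pow_mul]

/-! ## §2 `QQᵀ` is diagonal: the towers are disjoint and each tower block lies in `□₀` -/

open Classical in
/-- **`Q·Qᵀ = diag(L^{−(d+1)j_p})`** for the consumer's averaging matrix `Q` on the towers of the cube member (towers are disjoint, n05-e `towers_disjoint_cube`; the
block of a tower lies in `□₀`, n05-e `towerBlock_subset_cube`; a block of side `Lʲ` has `(L^{d+1})ʲ` sites).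
[cite: Balaban1985RegularSpaces, (1.31) p.81, p.91 (the operator `Q′`); Balaban1985BackgroundPropagators, (3.48) p.398] -/
theorem towerGram_QQt {L : ℕ} (hL : 1 ≤ L) (a : Fin (d + 1) → ℤ) (M : ℕ) {ρ : ℕ} (hρ : L ≤ ρ) {k n : ℕ} (hn : n ≤ k)
    (S : Finset (Fin (d + 1) → ℤ)) (hS : ∀ x, x ∈ S ↔ x ∈ cubeFam false L a M ρ k 0)
    (B : Finset (ℕ × (Fin (d + 1) → ℤ))) (hB : ∀ p, p ∈ B ↔ p.1 ≤ n ∧ p.2 ∈ cubeLamS L a M ρ k n p.1)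
    (Q : Matrix ↥B ↥S ℝ) (hQ : Q = Matrix.of (fun (p : ↥B) (z : ↥S) =>
      if blockMap (L ^ p.1.1) z.1 = p.1.2 then (((L : ℝ) ^ (d + 1))⁻¹) ^ p.1.1 else 0)) :
    Q * Qᵀ = Matrix.diagonal (fun p : ↥B => (((L : ℝ) ^ (d + 1))⁻¹) ^ p.1.1) := by
  have hL0 : (0 : ℝ) < L := by exact_mod_cast hL
  ext p p'
  rw [Matrix.mul_apply, Matrix.diagonal_apply]
  by_cases hpp : p = p'
  · subst hpp
    rw [if_pos rfl]
    obtain ⟨hp1, hp2⟩ := (hB p.1).mp p.2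
    -- the diagonal entry: `Σ_{z ∈ block p} c_p² = card · c_p² = c_p`
    have hterm : ∀ z : ↥S, Q p z * Qᵀ z p = if blockMap (L ^ p.1.1) z.1 = p.1.2 then ((((L : ℝ) ^ (d + 1))⁻¹) ^ p.1.1) ^ 2 else 0 := by
      intro z
      rw [Matrix.transpose_apply, hQ, Matrix.of_apply]
      split_ifs <;> ring
    rw [Finset.sum_congr rfl (fun z _ => hterm z)]
    obtain ⟨z₀, hz₀, hz₀b⟩ := tower_meets_cube hL a M hρ hn p.1.1 hp1 p.1.2 hp2
    have hfull : ∀ z, blockMap (L ^ p.1.1) z = blockMap (L ^ p.1.1) z₀ → z ∈ S := fun z hz =>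
      (hS z).mpr (towerBlock_subset_cube hL a M hρ hn hp1 (by rw [hz₀b]; exact hp2) hz)
    have hcard := card_filter_block_eq hL p.1.1 S z₀ hfull
    have hsum : ∑ z : ↥S, (if blockMap (L ^ p.1.1) z.1 = p.1.2 then ((((L : ℝ) ^ (d + 1))⁻¹) ^ p.1.1) ^ 2 else (0 : ℝ))
        = ((S.filter (fun z => blockMap (L ^ p.1.1) z = blockMap (L ^ p.1.1) z₀)).card : ℝ) * ((((L : ℝ) ^ (d + 1))⁻¹) ^ p.1.1) ^ 2 := by
      rw [Finset.sum_coe_sort S (fun z => if blockMap (L ^ p.1.1) z = p.1.2 then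
        ((((L : ℝ) ^ (d + 1))⁻¹) ^ p.1.1) ^ 2 else (0 : ℝ)), ← Finset.sum_filter, Finset.sum_const, nsmul_eq_mul, hz₀b]
    rw [hsum, hcard, inv_pow]
    field_simp
  · rw [if_neg hpp]
    refine Finset.sum_eq_zero fun z _ => ?_
    rw [Matrix.transpose_apply, hQ, Matrix.of_apply, Matrix.of_apply]
    by_cases h1 : blockMap (L ^ p.1.1) z.1 = p.1.2
    · by_cases h2 : blockMap (L ^ p'.1.1) z.1 = p'.1.2
      · exfalso
        obtain ⟨hp1, hp2⟩ := (hB p.1).mp p.2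
        obtain ⟨hp1', hp2'⟩ := (hB p'.1).mp p'.2
        obtain ⟨hjj, hyy⟩ := towers_disjoint_cube hL a M hρ hn p.1.1 hp1 p'.1.1 hp1' p.1.2 hp2 p'.1.2 hp2' z.1 ((hS z.1).mp z.2) h1 h2
        exact hpp (Subtype.ext (Prod.ext hjj hyy))
      · rw [if_neg h2, mul_zero]
    · rw [if_neg h1, zero_mul]

/-! ## §3 `T = η⁻²A + QᵀWQ`: the mass term of the consumer's `K` is `Qᵀ·diag(w_{j_p})·Q` -/

open Classical in
/-- **THE MASS TERM IS `QᵀWQ`**: for `x, z ∈ □₀`,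
`Σ_{j ≤ n}[Bʲ(x) ∈ Λs_j][Bʲ(z) = Bʲ(x)]·w_jL^{−2(d+1)j} = Σ_{p ∈ B} Q(p,x)·w_{j_p}·Q(p,z)` — the towers through `x` are the pairs `(j, Bʲ(x))`.
[cite: Balaban1985RegularSpaces, (1.91) p.91 (`Δ + Q′*aQ′`-form of the quadratic form); Balaban1984PropagatorsII, (2.13)–(2.14) p.225] -/
theorem massTerm_eq_QtWQ {L : ℕ} (a : Fin (d + 1) → ℤ) (M ρ k n : ℕ) (w : ℕ → ℝ)
    (S : Finset (Fin (d + 1) → ℤ))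
    (B : Finset (ℕ × (Fin (d + 1) → ℤ))) (hB : ∀ p, p ∈ B ↔ p.1 ≤ n ∧ p.2 ∈ cubeLamS L a M ρ k n p.1)
    (Q : Matrix ↥B ↥S ℝ) (hQ : Q = Matrix.of (fun (p : ↥B) (z : ↥S) =>
      if blockMap (L ^ p.1.1) z.1 = p.1.2 then (((L : ℝ) ^ (d + 1))⁻¹) ^ p.1.1 else 0))
    (x z : ↥S) :
    ∑ j ∈ Finset.range (n + 1), (if blockMap (L ^ j) x.1 ∈ cubeLamS L a M ρ k n j ∧ blockMap (L ^ j) z.1 = blockMap (L ^ j) x.1 then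
        w j * ((((L : ℝ) ^ (d + 1))⁻¹) ^ j) ^ 2 else 0)
      = (Qᵀ * Matrix.diagonal (fun p : ↥B => w p.1.1) * Q) x z := by
  -- the right-hand side as a sum over towers
  have hrhs : (Qᵀ * Matrix.diagonal (fun p : ↥B => w p.1.1) * Q) x z = ∑ p : ↥B, Q p x * w p.1.1 * Q p z := by
    rw [Matrix.mul_apply]
    refine Finset.sum_congr rfl fun p _ => ?_
    rw [Matrix.mul_diagonal, Matrix.transpose_apply]
  rw [hrhs]
  -- the summand over towers vanishes unless `p = (j, Bʲ(x))`
  have hsummand : ∀ p : ↥B, Q p x * w p.1.1 * Q p z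
      = if p.1.2 = blockMap (L ^ p.1.1) x.1 then
          (if blockMap (L ^ p.1.1) z.1 = blockMap (L ^ p.1.1) x.1 then w p.1.1 * ((((L : ℝ) ^ (d + 1))⁻¹) ^ p.1.1) ^ 2 else 0) else 0 := by
    intro p
    by_cases h1 : blockMap (L ^ p.1.1) x.1 = p.1.2
    · have hQx : Q p x = (((L : ℝ) ^ (d + 1))⁻¹) ^ p.1.1 := by rw [hQ, Matrix.of_apply, if_pos h1]
      rw [hQx, if_pos h1.symm, hQ, Matrix.of_apply, ← h1]
      split_ifs <;> ring
    · have hQx : Q p x = 0 := by rw [hQ, Matrix.of_apply, if_neg h1]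
      rw [hQx, zero_mul, zero_mul, if_neg (show ¬ (p.1.2 = blockMap (L ^ p.1.1) x.1) from fun h => h1 h.symm)]
  rw [Finset.sum_congr rfl (fun p _ => hsummand p)]
  -- reindex the towers through `x` by their level
  rw [Finset.sum_coe_sort B (fun p => if p.2 = blockMap (L ^ p.1) x.1 then
      (if blockMap (L ^ p.1) z.1 = blockMap (L ^ p.1) x.1 then w p.1 * ((((L : ℝ) ^ (d + 1))⁻¹) ^ p.1) ^ 2 else 0) else 0)]
  conv_rhs => rw [← Finset.sum_filter]
  -- the filtered tower set is the image of the levels `j` with `Bʲ(x) ∈ Λs_j` under `j ↦ (j, Bʲ(x))`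
  have hset : B.filter (fun p => p.2 = blockMap (L ^ p.1) x.1)
      = ((Finset.range (n + 1)).filter (fun j => blockMap (L ^ j) x.1 ∈ cubeLamS L a M ρ k n j)).image (fun j => (j, blockMap (L ^ j) x.1)) := by
    ext p
    rw [Finset.mem_filter, Finset.mem_image, hB]
    constructor
    · rintro ⟨⟨hp1, hp2⟩, hpx⟩
      refine ⟨p.1, Finset.mem_filter.mpr ⟨Finset.mem_range.mpr (Nat.lt_succ_of_le hp1), by rw [← hpx]; exact hp2⟩, ?_⟩
      exact Prod.ext rfl hpx.symm
    · rintro ⟨j, hj, rfl⟩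
      obtain ⟨hjr, hjt⟩ := Finset.mem_filter.mp hj
      exact ⟨⟨Nat.lt_succ_iff.mp (Finset.mem_range.mp hjr), hjt⟩, rfl⟩
  rw [hset, Finset.sum_image (fun j _ j' _ h => (Prod.ext_iff.mp h).1), Finset.sum_filter]
  refine Finset.sum_congr rfl fun j _ => ?_
  by_cases ht : blockMap (L ^ j) x.1 ∈ cubeLamS L a M ρ k n j
  · rw [if_pos ht]
    simp [ht]
  · rw [if_neg ht, if_neg (fun h => ht h.1)]

open Classical in
/-- **`T = η⁻²A_D + QᵀWQ`** — the consumer's flat matrix is the Dirichlet Laplacian stencil matrix times `η⁻²` plus `Qᵀ·diag(w_{j_p})·Q`.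
[cite: Balaban1985RegularSpaces, (1.91) p.91; Balaban1984PropagatorsII, (2.13)–(2.14) p.225] -/
theorem flatMatrix_eq_lap_add_QtWQ {η : ℝ} {L : ℕ} (a : Fin (d + 1) → ℤ) (M ρ k n : ℕ) (w : ℕ → ℝ)
    (S : Finset (Fin (d + 1) → ℤ))
    (B : Finset (ℕ × (Fin (d + 1) → ℤ))) (hB : ∀ p, p ∈ B ↔ p.1 ≤ n ∧ p.2 ∈ cubeLamS L a M ρ k n p.1)
    (K : (Fin (d + 1) → ℤ) → (Fin (d + 1) → ℤ) → ℝ)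
    (hK : ∀ x z, K x z = ((η ^ 2)⁻¹ * ∑ μ : Fin (d + 1), ((2 : ℝ) * (if z = x then (1 : ℝ) else 0) - (if z = x + e μ then (1 : ℝ) else 0)
        - (if z = x - e μ then (1 : ℝ) else 0))) +
        (∑ j ∈ Finset.range (n + 1), (if blockMap (L ^ j) x ∈ cubeLamS L a M ρ k n j ∧ blockMap (L ^ j) z = blockMap (L ^ j) x then
          w j * ((((L : ℝ) ^ (d + 1))⁻¹) ^ j) ^ 2 else 0)))
    (T : Matrix ↥S ↥S ℝ) (hT : T = Matrix.of (fun x z : ↥S => K x.1 z.1))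
    (Q : Matrix ↥B ↥S ℝ) (hQ : Q = Matrix.of (fun (p : ↥B) (z : ↥S) =>
      if blockMap (L ^ p.1.1) z.1 = p.1.2 then (((L : ℝ) ^ (d + 1))⁻¹) ^ p.1.1 else 0)) :
    T = (η ^ 2)⁻¹ • Matrix.of (fun x z : ↥S => ∑ μ : Fin (d + 1), ((2 : ℝ) * (if z.1 = x.1 then (1 : ℝ) else 0)
          - (if z.1 = x.1 + e μ then (1 : ℝ) else 0) - (if z.1 = x.1 - e μ then (1 : ℝ) else 0)))
        + Qᵀ * Matrix.diagonal (fun p : ↥B => w p.1.1) * Q := by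
  ext x z
  rw [hT, Matrix.of_apply, hK, Matrix.add_apply, Matrix.smul_apply, Matrix.of_apply, smul_eq_mul,
    massTerm_eq_QtWQ a M ρ k n w S B hB Q hQ x z]

open Classical in
/-- **`Q·T = η⁻²·Q·A_D + diag(L^{−(d+1)j_p}w_{j_p})·Q`** (from `T = η⁻²A_D + QᵀWQ` and `QQᵀ = diag(L^{−(d+1)j_p})`): the block averages of `Tλ` are the block
averages of `η⁻²(−Δλ)` plus `a′`-multiples of the block averages of `λ`. [cite: Balaban1985RegularSpaces, (1.91) p.91, p.93; Balaban1985BackgroundPropagators, (3.48) p.398] -/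
theorem Q_mul_flatMatrix {η : ℝ} {L : ℕ} (hL : 1 ≤ L) (a : Fin (d + 1) → ℤ) (M : ℕ) {ρ : ℕ} (hρ : L ≤ ρ) {k n : ℕ} (hn : n ≤ k) (w : ℕ → ℝ)
    (S : Finset (Fin (d + 1) → ℤ)) (hS : ∀ x, x ∈ S ↔ x ∈ cubeFam false L a M ρ k 0)
    (B : Finset (ℕ × (Fin (d + 1) → ℤ))) (hB : ∀ p, p ∈ B ↔ p.1 ≤ n ∧ p.2 ∈ cubeLamS L a M ρ k n p.1)
    (K : (Fin (d + 1) → ℤ) → (Fin (d + 1) → ℤ) → ℝ)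
    (hK : ∀ x z, K x z = ((η ^ 2)⁻¹ * ∑ μ : Fin (d + 1), ((2 : ℝ) * (if z = x then (1 : ℝ) else 0) - (if z = x + e μ then (1 : ℝ) else 0)
        - (if z = x - e μ then (1 : ℝ) else 0))) +
        (∑ j ∈ Finset.range (n + 1), (if blockMap (L ^ j) x ∈ cubeLamS L a M ρ k n j ∧ blockMap (L ^ j) z = blockMap (L ^ j) x then
          w j * ((((L : ℝ) ^ (d + 1))⁻¹) ^ j) ^ 2 else 0)))
    (T : Matrix ↥S ↥S ℝ) (hT : T = Matrix.of (fun x z : ↥S => K x.1 z.1))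
    (Q : Matrix ↥B ↥S ℝ) (hQ : Q = Matrix.of (fun (p : ↥B) (z : ↥S) =>
      if blockMap (L ^ p.1.1) z.1 = p.1.2 then (((L : ℝ) ^ (d + 1))⁻¹) ^ p.1.1 else 0)) :
    Q * T = (η ^ 2)⁻¹ • (Q * Matrix.of (fun x z : ↥S => ∑ μ : Fin (d + 1), ((2 : ℝ) * (if z.1 = x.1 then (1 : ℝ) else 0)
          - (if z.1 = x.1 + e μ then (1 : ℝ) else 0) - (if z.1 = x.1 - e μ then (1 : ℝ) else 0))))
        + Matrix.diagonal (fun p : ↥B => (((L : ℝ) ^ (d + 1))⁻¹) ^ p.1.1 * w p.1.1) * Q := by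
  rw [flatMatrix_eq_lap_add_QtWQ a M ρ k n w S B hB K hK T hT Q hQ, Matrix.mul_add, Matrix.mul_smul, ← Matrix.mul_assoc, ← Matrix.mul_assoc,
    towerGram_QQt hL a M hρ hn S hS B hB Q hQ, Matrix.diagonal_mul_diagonal]

end Literature.MathematicalPhysics.QuantumFieldTheory.Balaban1983to89.B8Eq348CubeMemberTowerGramAlgebra
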